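import Literature.AlgebraicGeometry.Resolution.ValuedFunctionFields
import Mathlib.RingTheory.KrullDimension.Basic
import HarnessLib

/-!
# A valuation ring of a finite extension is open in the normalization (Temkin 2013, §4.1, Step 3)

Topic: `Literature/AlgebraicGeometry/Resolution`. M. Temkin, *Inseparable local uniformization*,
J. Algebra 373 (2013) 65–119 = arXiv:0804.1554v3, proof of Thm. 4.1.1, Step 3 (p. 49): "Note
that `Cᵢ` is the projective limit of `X_{i,α}`'s by Proposition 2.3.8 (i) and similarly
`Nr_{mᵢ}(S)` is the projective limit of `Y_{i,α}`'s. Recall that `Sᵢ` is open in `Nr_{mᵢ}(S)`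
(this is even true for any valuation ring of finite height)." Here `S = Spec(k̄°)` for a valued
field `k̄` (of height one in the paper's situation), `mᵢ/k̄` is a finite extension of valued
fields, `Sᵢ = Spec(mᵢ°)` and `Nr_{mᵢ}(S) = Spec` of the integral closure of `k̄°` in `mᵢ`. The
classical background (N. Bourbaki, *Commutative Algebra*, Ch. VI, §8, no. 6, Prop. 6; cf.
R. Datta, Math. Nachr. 296 (2023), Prop. 3.6 (1) and Prop. 4.1: for a finite extension `l/k`
the integral closure `N` of `k°` in `l` is semilocal and its localizations at the maximal
ideals are exactly the valuation rings of `l` over `k°`) makes `Spec(m°) ⊆ Spec(N)` the set of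
primes inside one maximal ideal; for `k°` of finite height `Spec(N)` is finite, so this set is
open, hence a basic open `D(f)`, i.e. `m° = N[1/f]`. This is the form in which the openness is
used (the open immersion `Sᵢ → Nr_{mᵢ}(S)` is then a localization, smooth of finite
presentation, so that smooth-equivalence with the closed point of `Sᵢ` (Thm. 3.3.1,
Lemma 3.3.2) becomes smooth-equivalence with a point of `Nr_{mᵢ}(S)`, to which Lemma 2.8.4
applies).

* `Temkin2013_valuationRingOpen` — NAMED FACT: for a finite extension `l/k`, a valuation ring
  `k°` of `k` of finite height and a valuation ring `W` of `l` over `k°`, there is `f ∈ l`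
  integral over `k°` and invertible in `W` such that `W = Nr_l(k°)[1/f]`.

## Sources

* M. Temkin, *Inseparable local uniformization*, arXiv:0804.1554v3, proof of Thm. 4.1.1, Step 3
  (p. 49).
* N. Bourbaki, *Commutative Algebra*, Ch. VI, §8, no. 6, Prop. 6; R. Datta, *Essential finite
  generation of extensions of valuation rings*, Math. Nachr. 296 (2023), Prop. 3.6 (1),
  Prop. 4.1 (arXiv:2101.08337, pp. 8–9: "For the bijection see [Bou98, Chap. VI, §8.6, Prop. 6].
  If `L/K` is finite, then `A` has finitely many maximal ideals by part (1) of Proposition 3.6.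
  That there are finitely many valuation rings of `L` that dominate `V` now follows").

## Rendering notes

* `k° ⊆ l` is the subring `Ok.toSubring.map (algebraMap k l)`; "integral over `k°`" is
  `IsIntegral` over that subring; `W` over `k°` is `W.comap (algebraMap k l) = Ok`; finite height
  is `ringKrullDim Ok < ⊤`; "`Spec(W)` open in `Spec(N)`" is rendered by its consequence (and, `W`
  being local, equivalent form) "`Spec(W) = D(f)`", i.e. `W = N[1/f]` with `f ∈ N ∩ W^×`.
-/

namespace Literature.AlgebraicGeometry.Resolution

universe u

/-- NAMED FACT — **a valuation ring of a finite extension is open in the normalization of the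
base valuation ring** (Temkin 2013, proof of Thm. 4.1.1, Step 3, p. 49: "Recall that `Sᵢ` is
open in `Nr_{mᵢ}(S)` (this is even true for any valuation ring of finite height)"; classical:
Bourbaki, *Commutative Algebra* VI §8 no. 6 Prop. 6 — the valuation rings of `l` over `k°` are
the localizations of the semilocal integral closure `N = Nr_l(k°)` at its maximal ideals — and
finiteness of `Spec N` in finite height). Rendering: `l/k` finite, `Ok = k°` of finite height,
`W` a valuation ring of `l` with `W ∩ k = k°`; then there is `f ∈ l`, integral over `k°` and a
unit of `W`, such that `W = N[1/f]`: the elements of `W` are exactly the `a / fⁿ` with `a`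
integral over `k°`. Users take `(h : Temkin2013_valuationRingOpen)`.
[cite: Temkin2013, proof of Thm. 4.1.1 Step 3 (arXiv:0804.1554v3 p. 49)] -/
def Temkin2013_valuationRingOpen : Prop :=
  ∀ (k l : Type u) [Field k] [Field l] [Algebra k l], FiniteDimensional k l →
  ∀ (Ok : ValuationSubring k), ringKrullDim Ok < ⊤ →
  ∀ (W : ValuationSubring l), W.comap (algebraMap k l) = Ok →
    ∃ f : l, IsIntegral (Ok.toSubring.map (algebraMap k l)) f ∧ f ∈ W ∧ f⁻¹ ∈ W ∧
      ∀ x : l, x ∈ W ↔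
        ∃ a : l, IsIntegral (Ok.toSubring.map (algebraMap k l)) a ∧ ∃ n : ℕ, x = a / f ^ n

/-- Sanity: the easy inclusion packaged in the fact holds unconditionally — `a / fⁿ ∈ W`
whenever `a` is integral over `k° ⊆ W` and `f` is a unit of `W` (valuation rings are
integrally closed). [folklore] -/
theorem div_pow_mem_valuationSubring {k l : Type u} [Field k] [Field l] [Algebra k l]
    (Ok : ValuationSubring k) (W : ValuationSubring l) (hW : W.comap (algebraMap k l) = Ok)
    {f a : l} (hfi : f⁻¹ ∈ W) (ha : IsIntegral (Ok.toSubring.map (algebraMap k l)) a) (n : ℕ) :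
    a / f ^ n ∈ W := by
  -- `k° ⊆ W`
  have hle : Ok.toSubring.map (algebraMap k l) ≤ W.toSubring := by
    rintro _ ⟨c, hc, rfl⟩
    have : c ∈ W.comap (algebraMap k l) := by rw [hW]; exact hc
    exact this
  -- `a ∈ W` by integral closedness
  have haW : a ∈ W := by
    letI : Algebra (Ok.toSubring.map (algebraMap k l)) W := (Subring.inclusion hle).toAlgebra
    haveI : IsScalarTower (Ok.toSubring.map (algebraMap k l)) W l :=
      IsScalarTower.of_algebraMap_eq (fun _ => rfl)
    have ha' : IsIntegral W a := ha.tower_top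
    obtain ⟨y, rfl⟩ := IsIntegrallyClosed.algebraMap_eq_of_integral ha'
    exact y.2
  rw [div_eq_mul_inv, ← inv_pow]
  exact mul_mem haW (pow_mem hfi n)

end Literature.AlgebraicGeometry.Resolution
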